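import Mathlib
import HarnessLib
import Summits.HubbardSuperconductivity.HubbardSuperconductivity.Theorems.KLProgrammeKLRegimeEngineFrameShiftDressingFactorTables
import Literature.MathematicalPhysics.QuantumLattice.HubbardSliceSymbolJetsGevrey

/-!
# K3 gen-8-FLOW (stmt 20437 `KLRegimeEngineV17F2`, stub (C) `stub_twoLeg_curvature`): the (A)-side ALIAS TABLE at the flow frame `K_{m+1}` —
# `‖D^M[ŝ_{p₀} ∘ e_{K_{m+1}} ∘ 2π·]‖ ≤ (2π)^M·16·|βL²|·(2/Λ_{m+1})·(M!)²·(4E_u(m)(1 + 10976/Λ_{m+1}))^M`, every constant explicit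

Cell gate-hubbard-kl, seat p2 g15 (C4A-PLAN §22.3 input (iv) «alias tables [p2]» of the (A) capstone `…C4aSliceIncrementAssembly.twoLegCurveJetBound_succ_of_inputs`,
p584492: its hypothesis `hDa : ∀ p₀ y, ‖iteratedFDeriv ℝ Mdeg (fun y => sliceSymbolFnXi (βL²) 0 Λ_{n+1} Λ_n (ω_{p₀}) (frameLevel μ K ((2π)•y))) y‖ ≤ Da p₀`).
At the flow frame `K = klFlowFrameU … (m+1)` (the frame at which `…C4aReadJetAssembly.twoLegReadJetBound_flow_succ` reads (A)), the band `u = e_{K_{m+1}}` has the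
single-factorial geometric jets `‖Dⁱu‖ ≤ i!·E_u(m)ⁱ`, `E_u(m) = 4 + 4^m·2^{10}·(1 + S₀)` (`frameLevel_flowFrame_jets_factorial`, p576420, from the flow history
`FlowPieceJetsAt`/`TwoLegReadJetsF` below `m`), the cutoff's Gevrey table is a numeral (`SalmhoferCutoffGevrey`, p588775: `X₀ = 8`, `C_χ = 342`; flat order-4
table `X₄ = 8·576·342⁴` for `S₀`), and the slice symbol along a band obeys `Literature.….norm_iteratedFDeriv_sliceSymbolFnXi_comp_smul_le_numeral`; so

* **`norm_iteratedFDeriv_sliceSymbol_flowFrame_smul_le`** — for `0 < β`, `μ ∈ klWindowC`, the flow history up to `n ≥ m`, EVERY order `Mdeg`, every kept frequency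
  `p₀` and every `y`: the displayed bound, i.e. a CLOSED `Da p₀` (the same for all `p₀`) with no cutoff-table hypothesis;
* `sliceSymbol_flowFrame_aliasTable` — the `∀ p₀ y` form literally matching `hDa` at `K := klFlowFrameU … (m+1)`, `Λ := klScale klE0 (m+1)`, `Λ′ := klScale klE0 m`.

Proofs only; no definitions; nothing asserts superconductivity.  References: BGM 2006 §2.3 (2.36aa), §3 (3.2) [cite: BenfattoGiulianiMastropietro2006];
Salmhofer 1999 §4.2.5 (4.70).
-/

noncomputable section

namespace Summit.HubbardSuperconductivity.HubbardSuperconductivity.Theorems.EngineV8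

set_option linter.dupNamespace false -- summit = problem name (single-conjunct summit), D-0017

open Real Finset Literature.MathematicalPhysics.QuantumLattice Literature.Probability.LatticeModels
open Summit.HubbardSuperconductivity.HubbardSuperconductivity.Theorems.KLRegimeSplit
open Summit.HubbardSuperconductivity.HubbardSuperconductivity.Theorems.DispersionFlow
open Summit.HubbardSuperconductivity.HubbardSuperconductivity.Theorems.KLProgrammeLegKernels
open scoped Nat

variable {L M : ℕ} [NeZero L] [NeZero M]

section Flow

variable {G : GeoConsts} {Q : EngConsts} {R : RenConsts} (hR : ∀ j, 0 ≤ R.Gfr j) (hGS : ∀ k, 0 ≤ G.S k) (hQS : ∀ k, 0 ≤ Q.S' k)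
include hR hGS hQS

/-- **THE (A)-SIDE ALIAS TABLE AT THE FLOW FRAME `K_{m+1}`**: for every order `Mdeg`, every kept frequency `p₀` and every `y`,
`‖D^{Mdeg}[y ↦ ŝ_{p₀}(e_{K_{m+1}}((2π)•y))]‖ ≤ (2π)^{Mdeg}·(16·|βL²|·(2/Λ_{m+1})·(Mdeg!)²·(4E_u(m)(1 + 10976/Λ_{m+1}))^{Mdeg})`,
`E_u(m) = 4 + 4^m·2^{10}·(1 + S₀)`, `S₀ = π⁸(curveExtC X₄ G.S 1 + curveExtC X₄ Q.S′ 1·|U|)U² + Σ_{j<5} Gfr_j·uPow j U`, `X₄ = 8·576·342⁴`.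
[cite: BenfattoGiulianiMastropietro2006, §2.3 (2.36aa)] -/
theorem norm_iteratedFDeriv_sliceSymbol_flowFrame_smul_le {β U μ : ℝ} (hβ : 0 < β) (hμ : μ ∈ klWindowC)
    {n : ℕ} (hP : ∀ m' ≤ n, FlowPieceJetsAt L M β U μ R m') (hT : ∀ m' ≤ n, TwoLegReadJetsF L M G Q β U μ m')
    {m : ℕ} (hmn : m ≤ n) (Mdeg : ℕ) (p₀ : MatsubaraIdx M) (y : Momentum) :
    ‖iteratedFDeriv ℝ Mdeg (fun y : Momentum =>
        sliceSymbolFnXi (β * (L : ℝ) ^ 2) 0 (klScale klE0 (m + 1)) (klScale klE0 m) (matsubaraFreq β M p₀)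
          (frameLevel μ (klFlowFrameU L M β U μ (m + 1)) ((2 * Real.pi) • y))) y‖ ≤
      |2 * Real.pi| ^ Mdeg * (16 * |β * (L : ℝ) ^ 2| * (2 / klScale klE0 (m + 1)) * ((Mdeg ! : ℝ)) ^ 2 *
        (4 * (4 + (4 : ℝ) ^ m * (2 ^ 10 * (1 + (Real.pi ^ 8 * ((curveExtC (8 * 576 * (342 : ℝ) ^ 4) G.S 1 +
          curveExtC (8 * 576 * (342 : ℝ) ^ 4) Q.S' 1 * |U|) * U ^ 2) + ∑ j ∈ range 5, R.Gfr j * uPow j U)))) *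
          (1 + 10976 / klScale klE0 (m + 1))) ^ Mdeg) := by
  have hΛ : 0 < klScale klE0 (m + 1) := klth_klScale_pos (m + 1)
  have hΛΛ' : klScale klE0 (m + 1) ≤ klScale klE0 m := by
    rw [klth_klScale_succ]
    linarith [klth_klScale_pos m]
  have hω : matsubaraFreq β M p₀ ≠ 0 := matsubaraFreq_ne_zero hβ.ne' p₀
  have hX4 := salmhoferCutoff_flat_table_four
  have hEu : (0 : ℝ) ≤ 4 + (4 : ℝ) ^ m * (2 ^ 10 * (1 + (Real.pi ^ 8 * ((curveExtC (8 * 576 * (342 : ℝ) ^ 4) G.S 1 +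
      curveExtC (8 * 576 * (342 : ℝ) ^ 4) Q.S' 1 * |U|) * U ^ 2) + ∑ j ∈ range 5, R.Gfr j * uPow j U))) := by
    have hS : 0 ≤ Real.pi ^ 8 * ((curveExtC (8 * 576 * (342 : ℝ) ^ 4) G.S 1 + curveExtC (8 * 576 * (342 : ℝ) ^ 4) Q.S' 1 * |U|) * U ^ 2) +
        ∑ j ∈ range 5, R.Gfr j * uPow j U :=
      flowTableS0_nonneg hR hGS hQS ((norm_nonneg _).trans (hX4 0 (by norm_num) 0)) U
    positivity
  exact norm_iteratedFDeriv_sliceSymbolFnXi_comp_smul_le_numeral (c := β * (L : ℝ) ^ 2) hΛ hΛΛ' hω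
    (EngineV8.contDiff_frameLevel μ _) hEu
    (fun q i hi _ => frameLevel_flowFrame_jets_factorial hR hGS hQS hμ hX4 hP hT hmn hi q) (2 * Real.pi) y

/-- **The `hDa` form** of the (A) capstone at the flow frame: `∀ p₀ y, ‖…‖ ≤ Da` with the closed `Da` above (the same for all `p₀`).
[cite: BenfattoGiulianiMastropietro2006, §2.3 (2.36aa)] -/
theorem sliceSymbol_flowFrame_aliasTable {β U μ : ℝ} (hβ : 0 < β) (hμ : μ ∈ klWindowC)
    {n : ℕ} (hP : ∀ m' ≤ n, FlowPieceJetsAt L M β U μ R m') (hT : ∀ m' ≤ n, TwoLegReadJetsF L M G Q β U μ m')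
    {m : ℕ} (hmn : m ≤ n) (Mdeg : ℕ) :
    ∀ (p₀ : MatsubaraIdx M) (y : Momentum), ‖iteratedFDeriv ℝ Mdeg (fun y : Momentum =>
        sliceSymbolFnXi (β * (L : ℝ) ^ 2) 0 (klScale klE0 (m + 1)) (klScale klE0 m) (matsubaraFreq β M p₀)
          (frameLevel μ (klFlowFrameU L M β U μ (m + 1)) ((2 * Real.pi) • y))) y‖ ≤
      |2 * Real.pi| ^ Mdeg * (16 * |β * (L : ℝ) ^ 2| * (2 / klScale klE0 (m + 1)) * ((Mdeg ! : ℝ)) ^ 2 *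
        (4 * (4 + (4 : ℝ) ^ m * (2 ^ 10 * (1 + (Real.pi ^ 8 * ((curveExtC (8 * 576 * (342 : ℝ) ^ 4) G.S 1 +
          curveExtC (8 * 576 * (342 : ℝ) ^ 4) Q.S' 1 * |U|) * U ^ 2) + ∑ j ∈ range 5, R.Gfr j * uPow j U)))) *
          (1 + 10976 / klScale klE0 (m + 1))) ^ Mdeg) :=
  fun p₀ y => norm_iteratedFDeriv_sliceSymbol_flowFrame_smul_le hR hGS hQS hβ hμ hP hT hmn Mdeg p₀ y

end Flow

end Summit.HubbardSuperconductivity.HubbardSuperconductivity.Theorems.EngineV8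

end
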